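import Summits.QuantumFields.YangMills.Theorems.AtomicCalibrationROffDiagonalFlatness

/-!
# AtomicCalibrationR (stmt-QuantumFields-28169), E2 `stub_offDiagonalWhitney` — the distance to the fat diagonal
# (Plan A, step 1 of planner ym-idea-11 g15's `STUB-PLAN-offDiagonalWhitney.md`, and the flatness of step 2 in its terms)

Prover w4 g22 (free hands).  `distFat z`, the minimum over pairs of distinct slots `l ≠ l'` of `‖z_l − z_{l'}‖` (and `1` when there is
no such pair, `n ≤ 1`): it is attained at some pair, bounded by every pair, non-negative, vanishes exactly on the coincidence locus,
and is `2`-Lipschitz for the sup norm on `Fin n → E`.  Combined with `IsOffDiagonal.norm_iteratedFDeriv_le_of_pair`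
(`AtomicCalibrationROffDiagonalFlatness`): **`IsOffDiagonal.norm_iteratedFDeriv_le_distFat`** —
`‖D^m F(z)‖ ≤ p_{0,K}(F) · (distFat z / 2)^{K−m} / (K−m−1)!` for `F ∈ ⁰𝒮`, `m < K`, `n ≥ 2`.
One definition (`distFat`); Mathlib + the flatness file.  No stub/crux/rung/summit is closed; nothing here touches Yang–Mills; the
YM mass gap is NOT proved. [folklore]
-/

set_option autoImplicit false

noncomputable section

open scoped Nat
open Set
open Literature.MathematicalPhysics.AQFT (coincidenceLocus IsOffDiagonal)

namespace Summit.QuantumFields.YangMills.Cruxes.AtomicCalibrationR.OffDiagonalFlatness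

variable {E : Type} [NormedAddCommGroup E] {n : ℕ}

/-- The finite set of ordered pairs of distinct slots. -/
theorem pairs_nonempty_iff : ((Finset.univ : Finset (Fin n × Fin n)).filter fun p => p.1 ≠ p.2).Nonempty ↔ 2 ≤ n := by
  constructor
  · rintro ⟨p, hp⟩
    have h := (Finset.mem_filter.1 hp).2
    by_contra hlt
    have : Subsingleton (Fin n) := by
      rcases Nat.lt_succ_iff.1 (not_le.1 hlt) with h1
      · interval_cases n <;> infer_instance
    exact h (Subsingleton.elim _ _)
  · intro hn
    refine ⟨(⟨0, by omega⟩, ⟨1, by omega⟩), Finset.mem_filter.2 ⟨Finset.mem_univ _, ?_⟩⟩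
    simp [Fin.ext_iff]

/-- **Distance to the fat diagonal**: the least `‖z_l − z_{l'}‖` over pairs of distinct slots (`1` if `n ≤ 1`). -/
def distFat (z : Fin n → E) : ℝ :=
  if h : ((Finset.univ : Finset (Fin n × Fin n)).filter fun p => p.1 ≠ p.2).Nonempty then
    ((Finset.univ : Finset (Fin n × Fin n)).filter fun p => p.1 ≠ p.2).inf' h fun p => ‖z p.1 - z p.2‖
  else 1

/-- `distFat` is bounded by every pair distance. -/
theorem distFat_le (z : Fin n → E) {l l' : Fin n} (hll' : l ≠ l') : distFat z ≤ ‖z l - z l'‖ := by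
  have hmem : (l, l') ∈ (Finset.univ : Finset (Fin n × Fin n)).filter fun p => p.1 ≠ p.2 :=
    Finset.mem_filter.2 ⟨Finset.mem_univ _, hll'⟩
  rw [distFat, dif_pos ⟨_, hmem⟩]
  exact Finset.inf'_le (fun p : Fin n × Fin n => ‖z p.1 - z p.2‖) hmem

/-- `distFat` is attained at some pair of distinct slots (when `n ≥ 2`). -/
theorem exists_pair_distFat_eq (hn : 2 ≤ n) (z : Fin n → E) : ∃ l l' : Fin n, l ≠ l' ∧ distFat z = ‖z l - z l'‖ := by
  have h : ((Finset.univ : Finset (Fin n × Fin n)).filter fun p => p.1 ≠ p.2).Nonempty := pairs_nonempty_iff.2 hn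
  obtain ⟨p, hp, hpeq⟩ := Finset.exists_mem_eq_inf' h fun p : Fin n × Fin n => ‖z p.1 - z p.2‖
  refine ⟨p.1, p.2, (Finset.mem_filter.1 hp).2, ?_⟩
  rw [distFat, dif_pos h, hpeq]

/-- `distFat` without pairs is `1`. -/
theorem distFat_of_lt_two (hn : n < 2) (z : Fin n → E) : distFat z = 1 := by
  rw [distFat, dif_neg]
  exact fun h => (not_le.2 hn) (pairs_nonempty_iff.1 h)

/-- `distFat` is non-negative. -/
theorem distFat_nonneg (z : Fin n → E) : 0 ≤ distFat z := by
  rcases lt_or_ge n 2 with hn | hn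
  · rw [distFat_of_lt_two hn]; exact zero_le_one
  · obtain ⟨l, l', -, h⟩ := exists_pair_distFat_eq hn z
    rw [h]; exact norm_nonneg _

/-- `distFat` vanishes exactly on the coincidence locus (`n ≥ 2`). -/
theorem distFat_eq_zero_iff (hn : 2 ≤ n) (z : Fin n → E) : distFat z = 0 ↔ z ∈ coincidenceLocus n E := by
  constructor
  · intro h
    obtain ⟨l, l', hll', heq⟩ := exists_pair_distFat_eq hn z
    rw [h] at heq
    exact ⟨l, l', hll', sub_eq_zero.1 (norm_eq_zero.1 heq.symm)⟩
  · rintro ⟨l, l', hll', heq⟩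
    exact le_antisymm (by simpa [heq] using distFat_le z hll') (distFat_nonneg z)

/-- **`distFat` is `2`-Lipschitz** for the sup norm on `Fin n → E`. -/
theorem abs_distFat_sub_distFat_le (z w : Fin n → E) : |distFat z - distFat w| ≤ 2 * ‖z - w‖ := by
  rcases lt_or_ge n 2 with hn | hn
  · rw [distFat_of_lt_two hn, distFat_of_lt_two hn, sub_self, abs_zero]; positivity
  · -- one-sided bounds from the minimising pairs
    have key : ∀ z w : Fin n → E, distFat z - distFat w ≤ 2 * ‖z - w‖ := by
      intro z w
      obtain ⟨l, l', hll', heq⟩ := exists_pair_distFat_eq hn w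
      have h1 := distFat_le z hll'
      have h2 : ‖z l - z l'‖ ≤ ‖w l - w l'‖ + 2 * ‖z - w‖ := by
        have e : z l - z l' = (w l - w l') + ((z - w) l - (z - w) l') := by simp only [Pi.sub_apply]; abel
        rw [e]
        calc ‖(w l - w l') + ((z - w) l - (z - w) l')‖ ≤ ‖w l - w l'‖ + ‖(z - w) l - (z - w) l'‖ := norm_add_le _ _
          _ ≤ ‖w l - w l'‖ + (‖(z - w) l‖ + ‖(z - w) l'‖) := by gcongr; exact norm_sub_le _ _
          _ ≤ ‖w l - w l'‖ + (‖z - w‖ + ‖z - w‖) := by gcongr <;> exact norm_le_pi_norm _ _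
          _ = ‖w l - w l'‖ + 2 * ‖z - w‖ := by ring
      linarith
    rw [abs_le]
    constructor
    · have := key w z; rw [norm_sub_rev] at this; linarith
    · exact key z w

/-- **Flatness of `⁰𝒮` functions in terms of `distFat`** (`n ≥ 2`, `m < K`):
`‖D^m F(z)‖ ≤ p_{0,K}(F) · (distFat z / 2)^{K−m} / (K−m−1)!`. [folklore] -/
theorem _root_.Literature.MathematicalPhysics.AQFT.IsOffDiagonal.norm_iteratedFDeriv_le_distFat [NormedSpace ℝ E]
    {F : SchwartzMap (Fin n → E) ℂ} (hF : IsOffDiagonal F) (hn : 2 ≤ n) {K m : ℕ} (hm : m < K) (z : Fin n → E) :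
    ‖iteratedFDeriv ℝ m F z‖ ≤ SchwartzMap.seminorm ℝ 0 K F * (distFat z / 2) ^ (K - m) / (K - m - 1) ! := by
  obtain ⟨l, l', hll', heq⟩ := exists_pair_distFat_eq hn z
  rw [heq]
  exact hF.norm_iteratedFDeriv_le_of_pair hll' hm z

end Summit.QuantumFields.YangMills.Cruxes.AtomicCalibrationR.OffDiagonalFlatness

end
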